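import Summits.Ventures.HSemireg.WedgeHankelRankProfile
import Summits.Ventures.HSemireg.WedgeHankelRankProfileMonotone

/-!
# Venture HSemireg — THE RANK ROW OF EVERY CLASS IS A TRAPEZOID: for every coefficient sequence `q` over a field and every `0 ≤ k ≤ N`,
# **`rank H_k(q) = min(k + 1, N + 1 − k, R(q))`, `R(q) := rank H_{⌊N/2⌋}(q)`** — on the ascending side the rank grows by exactly one per degree until it STALLS, and a stall persists up
# to the middle (then D11's palindrome); hence with THEOREM H `dim V(univ, w_N(q), k) = C(N,k) · min(k+1, N+1−k, R(q))` for EVERY class: the shape of the census tables is a theorem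

HONEST FRAMING. Part of the Lean index of the computation cell `pub-hsemireg` (seat p10 gen 25, Sunday typer «UNIFORM-IN-n»).
LINEAR ALGEBRA OF HANKEL (catalecticant) MATRICES over a field ONLY: no variety, no cohomology theory, no sheaf, no Ext group and no semiregularity map is constructed here; nothing here says
that HC / HC_CM / HC_AV holds; no Literature fact is declared or used.  Custodian versions as in `WedgeHankelSiegelIdeal` (1/3); the dictionary (`rank H_k(q)` = the Hankel factor of THEOREM H;
`R(q)` = the rank in the middle degree, inside Sylvester's window in the fourth regime, H3) is QUOTED, never asserted.  The law was first CHECKED by brute force (GF(2), GF(3), every `q`,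
`N ≤ 9`: 90 613 sequences, 0 violations; script `HOME/p10/trapezoid-rank-profile-p10g25.py.txt`), then proved.

WHAT IS IN THE TREE / KEYED.  N13 (`WedgeHankelRankProfile`, keyed) `rank_hankel1_succ_le_add_one` (`rank H_{k+1} ≤ rank H_k + 1`); N14 (`WedgeHankelRankProfileMonotone`, keyed)
`rank_hankel1_le_rank_succ` (`2k+1 ≤ N ⇒ rank H_k ≤ rank H_{k+1}`); D11 `rank_hankel1_symm`; Mathlib `LinearMap.finrank_range_add_finrank_ker`, `Matrix.rank_le_height`.
THIS FILE (namespace `Summit.Ventures.HSemireg.Wedge.HankelOuter` continued; CHAINED on N13 and N14):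
* §458 **`rank_hankel1_stall_persists`** (`2k + 2 ≤ N`, `rank H_k(q) = rank H_{k+1}(q) ⇒ rank H_{k+1}(q) = rank H_{k+2}(q)`): with `Rel_j = ker H_j` (column relations), a stall means
  `Rel_k = pad(Rel_{k+1}) ⊕ K·shift(v_M)` (`v_M` a relation of maximal support `M`); then every relation `v` of `H_{k+1}` vanishing at `M` has its SHIFT again a relation of `H_{k+1}`, i.e. `v`
  satisfies one more Hankel row — so `{v ∈ Rel_{k+1} : v_M = 0}` (codimension `≤ 1`) embeds into `Rel_{k+2}`, `dim Rel_{k+2} ≥ dim Rel_{k+1} − 1`, `rank H_{k+2} ≤ rank H_{k+1}`; the other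
  inequality is N14 (or the palindrome at the middle).
* §459 `rank_hankel1_succ_eq_of_rank_le` (`2j + 2 ≤ N`, `rank H_j ≤ j ⇒ rank H_{j+1} = rank H_j`: below full row rank a stall has already happened), **`rank_hankel1_eq_min_left`** (`k ≤ j`,
  `2j ≤ N`: `rank H_k(q) = min(k+1, rank H_j(q))`), and THE TRAPEZOID LAW **`rank_hankel1_eq_min`** (`k ≤ N`: `rank H_k(q) = min(min(k+1, N+1−k), rank H_{N/2}(q))`).
READING: FORMULA-N's census tables list, per class, a rank row; this file says every such row is `min(k+1, N+1−k, R)` — one number `R(q)` per class determines the whole row (and by THEOREM H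
the whole dimension row `C(N,k)·rank`).  Nothing Ext-side.  New names only.
-/

open Module
open scoped Matrix

namespace Summit.Ventures.HSemireg.Wedge.HankelOuter

open Summit.Ventures.HSemireg.Wedge Summit.Ventures.HSemireg.Wedge.Kunneth Summit.Ventures.HSemireg.Wedge.Hankel
  Summit.Ventures.HSemireg.Wedge.BasisFree Summit.Ventures.HSemireg.Wedge.HankelSiegel Summit.Ventures.HSemireg.Wedge.HankelSiegelIdeal
  Summit.Ventures.HSemireg.Wedge.KunnethKernel Summit.Ventures.HSemireg.Wedge.HankelFrameChange Summit.Ventures.HSemireg.Wedge.KernelDuality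
  Summit.Ventures.HSemireg.Wedge.HankelSecant

variable (K : Type*) [Field K] {N : ℕ}

/-! ## §458. A stall of the rank profile persists -/

/-- **A STALL PERSISTS: `2k + 2 ≤ N`, `rank H_k(q) = rank H_{k+1}(q) ⇒ rank H_{k+1}(q) = rank H_{k+2}(q)`** (every field). -/
theorem rank_hankel1_stall_persists {k : ℕ} (hk : 2 * k + 2 ≤ N) (q : ℕ → K) (hstall : (hankel1 K N k q).rank = (hankel1 K N (k + 1) q).rank) :
    (hankel1 K N (k + 1) q).rank = (hankel1 K N (k + 2) q).rank := by
  classical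
  -- `≤`: N14 below the middle, the palindrome AT the middle
  have hge : (hankel1 K N (k + 1) q).rank ≤ (hankel1 K N (k + 2) q).rank := by
    rcases Nat.lt_or_ge (2 * k + 2) N with hlt | hle
    · exact rank_hankel1_le_rank_succ K (by omega) q
    · have hN : N = 2 * k + 2 := by omega
      rw [rank_hankel1_symm K (m := N) (k := k + 2) (by omega) q, show N - (k + 2) = k by omega, hstall]
  refine le_antisymm hge ?_
  -- the three catalecticants and their relation spaces
  set A := hankel1 K N (k + 1) q with hA
  set B := hankel1 K N k q with hB
  set C := hankel1 K N (k + 2) q with hC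
  have hrA := LinearMap.finrank_range_add_finrank_ker A.mulVecLin
  have hrB := LinearMap.finrank_range_add_finrank_ker B.mulVecLin
  have hrC := LinearMap.finrank_range_add_finrank_ker C.mulVecLin
  rw [finrank_fintype_fun_eq_card, Fintype.card_fin] at hrA hrB hrC
  have hrowsB : B.rank ≤ k + 1 := Matrix.rank_le_height _
  rw [Matrix.rank] at hrowsB
  have hstall' : finrank K ↥(LinearMap.range B.mulVecLin) = finrank K ↥(LinearMap.range A.mulVecLin) := by
    rw [← Matrix.rank, ← Matrix.rank]; exact hstall
  -- goal in kernel terms: `dim ker C + 1 ≥ dim ker A`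
  rw [Matrix.rank, Matrix.rank]
  suffices hker : finrank K ↥(LinearMap.ker A.mulVecLin) ≤ finrank K ↥(LinearMap.ker C.mulVecLin) + 1 by omega
  -- pad and shift `K^{c} → K^{c+1}` (`c = N − k` columns of `A`)
  set E : Matrix (Fin (N + 1 - k)) (Fin (N + 1 - (k + 1))) K := Matrix.of fun s t => if (s : ℕ) = (t : ℕ) then (1 : K) else 0 with hE
  set S : Matrix (Fin (N + 1 - k)) (Fin (N + 1 - (k + 1))) K := Matrix.of fun s t => if (s : ℕ) = (t : ℕ) + 1 then (1 : K) else 0 with hS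
  have hBE : B * E = A.submatrix (Fin.castSucc : Fin (k + 1) → Fin (k + 1 + 1)) id := by
    ext i t
    rw [Matrix.mul_apply, Matrix.submatrix_apply, Finset.sum_eq_single (⟨(t : ℕ), by omega⟩ : Fin (N + 1 - k))]
    · simp only [hE, hB, hA, Matrix.of_apply, if_true, mul_one, hankel1, id, Fin.val_castSucc]
    · intro s _ hs
      rw [hE, Matrix.of_apply, if_neg (fun e => hs (Fin.ext e)), mul_zero]
    · intro h; exact absurd (Finset.mem_univ _) h
  have hBS : B * S = A.submatrix (Fin.succ : Fin (k + 1) → Fin (k + 1 + 1)) id := by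
    ext i t
    rw [Matrix.mul_apply, Matrix.submatrix_apply, Finset.sum_eq_single (⟨(t : ℕ) + 1, by omega⟩ : Fin (N + 1 - k))]
    · simp only [hS, hB, hA, Matrix.of_apply, if_true, mul_one, hankel1, id, Fin.val_succ]
      congr 1
      omega
    · intro s _ hs
      rw [hS, Matrix.of_apply, if_neg (fun e => hs (Fin.ext e)), mul_zero]
    · intro h; exact absurd (Finset.mem_univ _) h
  have hsub : ∀ (r : Fin (k + 1) → Fin (k + 1 + 1)) (v : Fin (N + 1 - (k + 1)) → K), A *ᵥ v = 0 → (A.submatrix r id) *ᵥ v = 0 := by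
    intro r v hv
    funext i
    have := congrFun hv (r i)
    rw [Pi.zero_apply] at this ⊢
    rw [← this]
    rfl
  have hPad : ∀ a ∈ LinearMap.ker A.mulVecLin, E.mulVecLin a ∈ LinearMap.ker B.mulVecLin := by
    intro a ha
    rw [LinearMap.mem_ker, Matrix.mulVecLin_apply] at ha ⊢
    rw [Matrix.mulVecLin_apply, Matrix.mulVec_mulVec, hBE, hsub _ a ha]
  have hShift : ∀ a ∈ LinearMap.ker A.mulVecLin, S.mulVecLin a ∈ LinearMap.ker B.mulVecLin := by
    intro a ha
    rw [LinearMap.mem_ker, Matrix.mulVecLin_apply] at ha ⊢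
    rw [Matrix.mulVecLin_apply, Matrix.mulVec_mulVec, hBS, hsub _ a ha]
  have hEapp : ∀ (a : Fin (N + 1 - (k + 1)) → K) (s : Fin (N + 1 - k)),
      (E *ᵥ a) s = if h : (s : ℕ) < N + 1 - (k + 1) then a ⟨(s : ℕ), h⟩ else 0 := by
    intro a s
    simp only [Matrix.mulVec, dotProduct]
    by_cases h : (s : ℕ) < N + 1 - (k + 1)
    · rw [dif_pos h, Finset.sum_eq_single (⟨(s : ℕ), h⟩ : Fin (N + 1 - (k + 1)))]
      · rw [hE, Matrix.of_apply, if_pos rfl, one_mul]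
      · intro t _ ht; rw [hE, Matrix.of_apply, if_neg (fun e => ht (Fin.ext e.symm)), zero_mul]
      · intro hh; exact absurd (Finset.mem_univ _) hh
    · rw [dif_neg h]
      exact Finset.sum_eq_zero fun t _ => by rw [hE, Matrix.of_apply, if_neg (by have := t.2; omega), zero_mul]
  have hSapp : ∀ (a : Fin (N + 1 - (k + 1)) → K) (s : Fin (N + 1 - k)),
      (S *ᵥ a) s = if h : 0 < (s : ℕ) then a ⟨(s : ℕ) - 1, by omega⟩ else 0 := by
    intro a s
    simp only [Matrix.mulVec, dotProduct]
    by_cases h : 0 < (s : ℕ)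
    · rw [dif_pos h, Finset.sum_eq_single (⟨(s : ℕ) - 1, by omega⟩ : Fin (N + 1 - (k + 1)))]
      · rw [hS, Matrix.of_apply, if_pos (by simp only; omega), one_mul]
      · intro t _ ht; rw [hS, Matrix.of_apply, if_neg (fun e => ht (Fin.ext (by simp only at e ⊢; omega))), zero_mul]
      · intro hh; exact absurd (Finset.mem_univ _) hh
    · rw [dif_neg h]
      exact Finset.sum_eq_zero fun t _ => by rw [hS, Matrix.of_apply, if_neg (by omega), zero_mul]
  have hEinj : Function.Injective E.mulVecLin := by
    intro a a' h
    funext t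
    have := congrFun h (⟨(t : ℕ), by omega⟩ : Fin (N + 1 - k))
    rw [Matrix.mulVecLin_apply, Matrix.mulVecLin_apply, hEapp, hEapp, dif_pos t.2, dif_pos t.2] at this
    exact this
  -- `ker A ≠ 0` (a stall below the middle forces a relation) and the highest index `M` carried by a relation
  have hd : 1 ≤ finrank K ↥(LinearMap.ker A.mulVecLin) := by omega
  have hkerA : LinearMap.ker A.mulVecLin ≠ ⊥ := by
    intro h0; rw [h0, finrank_bot] at hd; omega
  obtain ⟨a₁, ha₁, hne₁⟩ := (Submodule.ne_bot_iff _).mp hkerA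
  obtain ⟨t₁, ht₁⟩ : ∃ t, a₁ t ≠ 0 := by
    by_contra hall
    simp only [not_exists, not_not] at hall
    exact hne₁ (funext hall)
  set I := Finset.univ.filter (fun t : Fin (N + 1 - (k + 1)) => ∃ a ∈ LinearMap.ker A.mulVecLin, a t ≠ 0) with hI
  have hIne : I.Nonempty := ⟨t₁, by rw [hI, Finset.mem_filter]; exact ⟨Finset.mem_univ _, a₁, ha₁, ht₁⟩⟩
  set M := I.max' hIne with hM
  have hMI : M ∈ I := Finset.max'_mem I hIne
  obtain ⟨vM, hvM, hvMM⟩ : ∃ a ∈ LinearMap.ker A.mulVecLin, a M ≠ 0 := by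
    have := hMI; rw [hI, Finset.mem_filter] at this; exact this.2
  have hvan : ∀ a ∈ LinearMap.ker A.mulVecLin, ∀ t : Fin (N + 1 - (k + 1)), (M : ℕ) < t → a t = 0 := by
    intro a ha t hmt
    by_contra hne
    have htI : t ∈ I := by rw [hI, Finset.mem_filter]; exact ⟨Finset.mem_univ _, a, ha, hne⟩
    have := Finset.le_max' I t htI
    rw [← hM] at this
    exact absurd hmt (not_lt.mpr this)
  -- `ker B = pad(ker A) ⊔ K·shift(v_M)` (the stall: both sides have dimension `dim ker A + 1`)
  have hnot : S.mulVecLin vM ∉ (LinearMap.ker A.mulVecLin).map E.mulVecLin := by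
    rintro ⟨a, ha, hEq⟩
    have h1 := congrFun hEq (⟨(M : ℕ) + 1, by omega⟩ : Fin (N + 1 - k))
    rw [Matrix.mulVecLin_apply, Matrix.mulVecLin_apply, hEapp, hSapp, dif_pos (show 0 < (M : ℕ) + 1 by omega)] at h1
    simp only [Nat.add_sub_cancel, Fin.eta] at h1
    by_cases hlt : (M : ℕ) + 1 < N + 1 - (k + 1)
    · rw [dif_pos hlt, hvan a ha ⟨(M : ℕ) + 1, hlt⟩ (show (M : ℕ) < (M : ℕ) + 1 by omega)] at h1
      exact hvMM h1.symm
    · rw [dif_neg hlt] at h1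
      exact hvMM h1.symm
  have hdecomp : LinearMap.ker B.mulVecLin = (LinearMap.ker A.mulVecLin).map E.mulVecLin ⊔ K ∙ S.mulVecLin vM := by
    symm
    refine Submodule.eq_of_le_of_finrank_eq (sup_le (by rintro _ ⟨a, ha, rfl⟩; exact hPad a ha) ?_) ?_
    · rw [Submodule.span_singleton_le_iff_mem]; exact hShift vM hvM
    · have hdisj : (LinearMap.ker A.mulVecLin).map E.mulVecLin ⊓ (K ∙ S.mulVecLin vM) = ⊥ := by
        rw [Submodule.eq_bot_iff]
        intro x hx
        obtain ⟨hx1, hx2⟩ := Submodule.mem_inf.mp hx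
        obtain ⟨c, rfl⟩ := Submodule.mem_span_singleton.mp hx2
        by_cases hc : c = 0
        · rw [hc, zero_smul]
        · exact absurd ((Submodule.smul_mem_iff _ hc).mp hx1) hnot
      have hsum := Submodule.finrank_sup_add_finrank_inf_eq ((LinearMap.ker A.mulVecLin).map E.mulVecLin) (K ∙ S.mulVecLin vM)
      rw [hdisj, finrank_bot, add_zero, (Submodule.equivMapOfInjective _ hEinj (LinearMap.ker A.mulVecLin)).finrank_eq.symm,
        finrank_span_singleton (fun h0 => hnot (by rw [h0]; exact Submodule.zero_mem _))] at hsum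
      omega
  -- sums over `Fin n` as sums over `range n` of the zero-extended vector
  have hext : ∀ (v : Fin (N + 1 - (k + 1)) → K) (g : ℕ → K) (n : ℕ) (hn : n ≤ N + 1 - (k + 1)),
      (∑ t ∈ Finset.range n, g t * (if h : t < N + 1 - (k + 1) then v ⟨t, h⟩ else 0))
        = ∑ s : Fin n, g (s : ℕ) * v ⟨(s : ℕ), by omega⟩ := by
    intro v g n hn
    rw [← Fin.sum_univ_eq_sum_range (fun t => g t * (if h : t < N + 1 - (k + 1) then v ⟨t, h⟩ else 0)) n]
    exact Finset.sum_congr rfl fun s _ => by rw [dif_pos (by omega)]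
  have hrange1 : Finset.range (N + 1 - (k + 1)) = Finset.range (N - k - 1 + 1) := by congr 1; omega
  have hrange2 : Finset.range (N + 1 - (k + 2)) = Finset.range (N - k - 1) := by congr 1; omega
  -- the rows of `A v = 0` as range sums
  have hrowA : ∀ v ∈ LinearMap.ker A.mulVecLin, ∀ i : Fin (k + 1 + 1),
      (∑ t ∈ Finset.range (N + 1 - (k + 1)), q ((i : ℕ) + t) * (if h : t < N + 1 - (k + 1) then v ⟨t, h⟩ else 0)) = 0 := by
    intro v hv i
    have h1 := congrFun (LinearMap.mem_ker.mp hv) i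
    rw [Matrix.mulVecLin_apply, Pi.zero_apply] at h1
    simp only [Matrix.mulVec, dotProduct, hA, hankel1, Matrix.of_apply] at h1
    rw [hext v _ _ le_rfl]
    exact h1
  have hlastzero : ∀ v ∈ LinearMap.ker A.mulVecLin, v M = 0 → ∀ s : Fin (N + 1 - (k + 1)), N - k - 1 ≤ (s : ℕ) → v s = 0 := by
    intro v hv hvM0 s hs
    by_cases hMs : (M : ℕ) < s
    · exact hvan v hv s hMs
    · have hM2 := M.2
      have hs2 := s.2
      have e : s = M := Fin.ext (by omega)
      rw [e]; exact hvM0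
  -- a relation of `A` vanishing at `M` shifts to a relation of `A`: it satisfies ONE MORE Hankel row
  have hrow : ∀ v ∈ LinearMap.ker A.mulVecLin, v M = 0 →
      (∑ t ∈ Finset.range (N + 1 - (k + 1)), q (k + 2 + t) * (if h : t < N + 1 - (k + 1) then v ⟨t, h⟩ else 0)) = 0 := by
    intro v hv hvM0
    have hSv : S.mulVecLin v ∈ (LinearMap.ker A.mulVecLin).map E.mulVecLin ⊔ K ∙ S.mulVecLin vM := by
      rw [← hdecomp]; exact hShift v hv
    obtain ⟨y, hy, z, hz, hyz⟩ := Submodule.mem_sup.mp hSv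
    obtain ⟨a, ha, rfl⟩ := hy
    obtain ⟨c, rfl⟩ := Submodule.mem_span_singleton.mp hz
    -- coordinate `M + 1`: `c = 0`
    have haM : (if h : (M : ℕ) + 1 < N + 1 - (k + 1) then a ⟨(M : ℕ) + 1, h⟩ else 0) = 0 := by
      by_cases hlt : (M : ℕ) + 1 < N + 1 - (k + 1)
      · rw [dif_pos hlt]; exact hvan a ha ⟨(M : ℕ) + 1, hlt⟩ (show (M : ℕ) < (M : ℕ) + 1 by omega)
      · rw [dif_neg hlt]
    have hc : c = 0 := by
      have h1 := congrFun hyz (⟨(M : ℕ) + 1, by omega⟩ : Fin (N + 1 - k))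
      rw [Pi.add_apply, Pi.smul_apply, Matrix.mulVecLin_apply, Matrix.mulVecLin_apply, Matrix.mulVecLin_apply, hEapp, hSapp, hSapp,
        dif_pos (show 0 < (M : ℕ) + 1 by omega), dif_pos (show 0 < (M : ℕ) + 1 by omega)] at h1
      simp only [Nat.add_sub_cancel, Fin.eta] at h1
      rw [haM, zero_add, hvM0, smul_eq_mul] at h1
      by_contra hc
      exact hvMM ((mul_eq_zero.mp h1).resolve_left hc)
    rw [hc, zero_smul, add_zero] at hyz
    -- `pad a = shift v`: `a_0 = 0`, `a_{t+1} = v_t`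
    have ha0 : (if h : 0 < N + 1 - (k + 1) then a ⟨0, h⟩ else 0) = 0 := by
      have h1 := congrFun hyz (⟨0, by omega⟩ : Fin (N + 1 - k))
      rw [Matrix.mulVecLin_apply, Matrix.mulVecLin_apply, hEapp, hSapp, dif_neg (show ¬ 0 < 0 by omega), dif_pos (show 0 < N + 1 - (k + 1) by omega)] at h1
      rw [dif_pos (show 0 < N + 1 - (k + 1) by omega)]
      exact h1
    have hasucc : ∀ t : ℕ, t < N - k - 1 →
        (if h : t + 1 < N + 1 - (k + 1) then a ⟨t + 1, h⟩ else 0) = (if h : t < N + 1 - (k + 1) then v ⟨t, h⟩ else 0) := by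
      intro t ht
      have h1 := congrFun hyz (⟨t + 1, by omega⟩ : Fin (N + 1 - k))
      rw [Matrix.mulVecLin_apply, Matrix.mulVecLin_apply, hEapp, hSapp, dif_pos (show 0 < t + 1 by omega)] at h1
      simp only [Nat.add_sub_cancel] at h1
      rw [dif_pos (show t < N + 1 - (k + 1) by omega)]
      exact h1
    have hvlast : (if h : N - k - 1 < N + 1 - (k + 1) then v ⟨N - k - 1, h⟩ else 0) = 0 := by
      rw [dif_pos (by omega)]
      exact hlastzero v hv hvM0 _ (show N - k - 1 ≤ N - k - 1 from le_rfl)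
    -- row `k + 1` of `A a = 0`, reindexed
    have hAa := hrowA a ha (Fin.last (k + 1))
    rw [Fin.val_last, hrange1, Finset.sum_range_succ', ha0, mul_zero, add_zero] at hAa
    rw [hrange1, Finset.sum_range_succ, hvlast, mul_zero, add_zero]
    refine (Finset.sum_congr rfl fun t ht => ?_).trans hAa
    rw [hasucc t (Finset.mem_range.mp ht), show k + 1 + (t + 1) = k + 2 + t by omega]
  -- the relations of `A` vanishing at `M` (codimension ≤ 1) truncate injectively into relations of `C`
  set φ : ↥(LinearMap.ker A.mulVecLin) →ₗ[K] K := (LinearMap.proj M).comp (LinearMap.ker A.mulVecLin).subtype with hφ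
  have hφapp : ∀ u : ↥(LinearMap.ker A.mulVecLin), φ u = (u : Fin (N + 1 - (k + 1)) → K) M := fun u => rfl
  have hφker : finrank K ↥(LinearMap.ker A.mulVecLin) ≤ finrank K ↥(LinearMap.ker φ) + 1 := by
    have h1 := LinearMap.finrank_range_add_finrank_ker φ
    have h2 : finrank K ↥(LinearMap.range φ) ≤ 1 := by
      have := Submodule.finrank_le (LinearMap.range φ); rwa [Module.finrank_self] at this
    omega
  set τ : (Fin (N + 1 - (k + 1)) → K) →ₗ[K] (Fin (N + 1 - (k + 2)) → K) :=
    LinearMap.funLeft K K (fun s : Fin (N + 1 - (k + 2)) => (⟨(s : ℕ), by omega⟩ : Fin (N + 1 - (k + 1)))) with hτ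
  have hτapp : ∀ (v : Fin (N + 1 - (k + 1)) → K) (s : Fin (N + 1 - (k + 2))), τ v s = v ⟨(s : ℕ), by omega⟩ := fun v s => rfl
  have hτC : ∀ v ∈ LinearMap.ker A.mulVecLin, v M = 0 → τ v ∈ LinearMap.ker C.mulVecLin := by
    intro v hv hvM0
    rw [LinearMap.mem_ker, Matrix.mulVecLin_apply]
    funext i'
    rw [Pi.zero_apply]
    simp only [Matrix.mulVec, dotProduct, hC, hankel1, Matrix.of_apply, hτapp]
    rw [← hext v (fun t => q ((i' : ℕ) + t)) (N + 1 - (k + 2)) (by omega), hrange2]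
    have hfull : (∑ t ∈ Finset.range (N + 1 - (k + 1)), q ((i' : ℕ) + t) * (if h : t < N + 1 - (k + 1) then v ⟨t, h⟩ else 0)) = 0 := by
      have hi' := i'.2
      by_cases hlast : (i' : ℕ) = k + 2
      · rw [hlast]; exact hrow v hv hvM0
      · have := hrowA v hv ⟨(i' : ℕ), by omega⟩
        simpa only using this
    rw [hrange1, Finset.sum_range_succ, dif_pos (show N - k - 1 < N + 1 - (k + 1) by omega),
      hlastzero v hv hvM0 _ (show N - k - 1 ≤ N - k - 1 from le_rfl), mul_zero, add_zero] at hfull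
    exact hfull
  -- the truncation, restricted to `ker φ`, is injective with image in `ker C`
  set ψ : ↥(LinearMap.ker φ) →ₗ[K] (Fin (N + 1 - (k + 2)) → K) := (τ.comp (LinearMap.ker A.mulVecLin).subtype).comp (LinearMap.ker φ).subtype with hψ
  have hψapp : ∀ u : ↥(LinearMap.ker φ), ψ u = τ ((u : ↥(LinearMap.ker A.mulVecLin)) : Fin (N + 1 - (k + 1)) → K) := fun u => rfl
  have hψinj : Function.Injective ψ := by
    intro u u' h
    apply Subtype.ext; apply Subtype.ext
    funext s
    have hu : ((u : ↥(LinearMap.ker A.mulVecLin)) : Fin (N + 1 - (k + 1)) → K) M = 0 := by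
      have := LinearMap.mem_ker.mp u.2; rwa [hφapp] at this
    have hu' : ((u' : ↥(LinearMap.ker A.mulVecLin)) : Fin (N + 1 - (k + 1)) → K) M = 0 := by
      have := LinearMap.mem_ker.mp u'.2; rwa [hφapp] at this
    by_cases hs : (s : ℕ) < N + 1 - (k + 2)
    · have := congrFun h ⟨(s : ℕ), hs⟩
      rw [hψapp, hψapp, hτapp, hτapp] at this
      simpa only [Fin.eta] using this
    · rw [hlastzero _ (u : ↥(LinearMap.ker A.mulVecLin)).2 hu s (by omega), hlastzero _ (u' : ↥(LinearMap.ker A.mulVecLin)).2 hu' s (by omega)]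
  have hψle : LinearMap.range ψ ≤ LinearMap.ker C.mulVecLin := by
    rintro _ ⟨u, rfl⟩
    rw [hψapp]
    have hu : ((u : ↥(LinearMap.ker A.mulVecLin)) : Fin (N + 1 - (k + 1)) → K) M = 0 := by
      have := LinearMap.mem_ker.mp u.2; rwa [hφapp] at this
    exact hτC _ (u : ↥(LinearMap.ker A.mulVecLin)).2 hu
  have h3 := Submodule.finrank_mono hψle
  rw [LinearMap.finrank_range_of_inj hψinj] at h3
  omega

/-! ## §459. The trapezoid law -/

/-- below full row rank a stall has already happened: **`2j + 2 ≤ N`, `rank H_j(q) ≤ j ⇒ rank H_{j+1}(q) = rank H_j(q)`.** -/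
theorem rank_hankel1_succ_eq_of_rank_le {j : ℕ} (hj : 2 * j + 2 ≤ N) (q : ℕ → K) (hr : (hankel1 K N j q).rank ≤ j) :
    (hankel1 K N (j + 1) q).rank = (hankel1 K N j q).rank := by
  induction j with
  | zero =>
    -- `rank H_0 = 0`: `q` vanishes on `[0, N]`, so every `H_k` is zero
    have h0 : hankel1 K N 0 q = 0 := by
      have : (hankel1 K N 0 q).rank = 0 := by omega
      rw [Matrix.rank, Submodule.finrank_eq_zero, LinearMap.range_eq_bot] at this
      ext i s
      have := congrFun (LinearMap.congr_fun this (Pi.single s 1)) i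
      rw [Matrix.mulVecLin_apply, Matrix.mulVec_single_one, LinearMap.zero_apply] at this
      exact this
    have hq : ∀ t ≤ N, q t = 0 := by
      intro t ht
      have := congrFun (congrFun h0 0) ⟨t, by omega⟩
      simpa [hankel1] using this
    have h1 : hankel1 K N (0 + 1) q = 0 := by
      ext i s
      simp only [hankel1, Matrix.of_apply, Matrix.zero_apply]
      exact hq _ (by have := i.2; have := s.2; omega)
    rw [h1, h0, Matrix.rank_zero, Matrix.rank_zero]
  | succ j ih =>
    -- `rank H_{j+1} ≤ j + 1`: either already `rank H_j ≤ j` (then stall at `j` by induction, which persists), or `rank H_j = j + 1 = rank H_{j+1}` (a stall at `j`)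
    have hmono := rank_hankel1_le_rank_succ K (show 2 * j + 1 ≤ N by omega) q
    have hstall : (hankel1 K N j q).rank = (hankel1 K N (j + 1) q).rank := by
      rcases Nat.lt_or_ge ((hankel1 K N j q).rank) (j + 1) with hlt | hge
      · exact (ih (by omega) (by omega)).symm
      · have : (hankel1 K N j q).rank ≤ j + 1 := Matrix.rank_le_height _
        omega
    exact (rank_hankel1_stall_persists K (by omega) q hstall).symm

/-- **`rank H_k(q) = min(k + 1, rank H_j(q))` for `k ≤ j` with `2j ≤ N`**: on the ascending side the rank grows by one per degree until it stalls, and stalls persist. -/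
theorem rank_hankel1_eq_min_left {k j : ℕ} (hkj : k ≤ j) (hj : 2 * j ≤ N) (q : ℕ → K) :
    (hankel1 K N k q).rank = min (k + 1) ((hankel1 K N j q).rank) := by
  induction j with
  | zero =>
    obtain rfl : k = 0 := by omega
    exact (min_eq_right (Matrix.rank_le_height _)).symm
  | succ j ih =>
    rcases Nat.lt_or_ge k (j + 1) with hlt | hge
    · have ih' := ih (by omega) (by omega)
      rcases Nat.lt_or_ge ((hankel1 K N j q).rank) (j + 1) with hrj | hrj
      · rw [rank_hankel1_succ_eq_of_rank_le K (by omega) q (by omega)]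
        exact ih'
      · have hrows : (hankel1 K N j q).rank ≤ j + 1 := Matrix.rank_le_height _
        have hmono := rank_hankel1_le_rank_succ K (show 2 * j + 1 ≤ N by omega) q
        rw [ih', min_eq_left (by omega : k + 1 ≤ (hankel1 K N j q).rank), min_eq_left (by omega)]
    · obtain rfl : k = j + 1 := by omega
      exact (min_eq_right (Matrix.rank_le_height _)).symm

/-- **THE TRAPEZOID LAW: `rank H_k(q) = min(min(k + 1, N + 1 − k), rank H_{⌊N/2⌋}(q))` for every `k ≤ N`, every coefficient sequence `q`, every field** — with THEOREM H: the dimension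
row `dim V(univ, w_N(q), k) = C(N,k) · rank H_k(q)` of EVERY class is `C(N,k) · min(k+1, N+1−k, R(q))`. -/
theorem rank_hankel1_eq_min {k : ℕ} (hk : k ≤ N) (q : ℕ → K) :
    (hankel1 K N k q).rank = min (min (k + 1) (N + 1 - k)) ((hankel1 K N (N / 2) q).rank) := by
  rcases le_or_gt k (N / 2) with hle | hgt
  · rw [rank_hankel1_eq_min_left K hle (Nat.mul_div_le N 2) q, min_eq_left (show k + 1 ≤ N + 1 - k by omega)]
  · -- the descending side by the palindrome `rank H_k = rank H_{N−k}`
    rw [rank_hankel1_symm K (m := N) hk q, rank_hankel1_eq_min_left K (show N - k ≤ N / 2 by omega) (Nat.mul_div_le N 2) q,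
      show N - k + 1 = N + 1 - k by omega, min_eq_right (show N + 1 - k ≤ k + 1 by omega)]

end Summit.Ventures.HSemireg.Wedge.HankelOuter
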